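import Mathlib
import Summits.MatrixMultiplication.MatrixMultiplication.Theorems.SnSubsetDichotomyPolynomialSlackMatchingCostAvoid

/-!
# The cost of partially avoiding a family of sets at distinct rows (`ε`-version)

Crux `Summit.MatrixMultiplication.MatrixMultiplication.Theses.SnSubsetDichotomy.PolynomialSlack`
(item `stmt-MatrixMultiplication-8306`), level-one programme, line transport-split-hull (lead c10),
the `ε`-depleted matching branch of the 3/4 step.  Generalises `matching_cost_avoid` (which asks that
only a `1/64` fraction of `A` maps each row into a set of size `≥ n/16`) to an arbitrary depletion
factor `ε` and arbitrary set sizes: if at `m` distinct rows `row c` the dense set `A ⊆ S_n` sends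
`a⁻¹(row c)` into `Q c` with probability at most `(1 - ε)|Q c|/n`, then the TOTAL relative size of the
sets is small, `∑_c |Q c|/n ≤ 144 (1+log n) log(4 (n!/|A|)/ε)/ε²`.
Proof (as `matching_cost_avoid`): with `Z(a) = #{c : a⁻¹(row c) ∈ Q c}` and `μ = ∑_c |Q c|/n` its
uniform mean, `E_A Z ≤ (1-ε) μ` and `Z ≥ 0` give (Markov) at least `(ε/2)|A|` elements with
`Z < μ - ε μ/2`; transport `a ↦ a⁻¹` to the permuted sum of the `0/1` array
`b(x, y) = [∃ c, row c = x ∧ y ∈ Q c]` (`∑ b² = n μ`, range `1`) and apply `card_permutedSum_tail_le`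
with `t = ε μ / 2`: `(ε/2)|A| ≤ 2 n! exp(-ε² μ/(128 (1+log n) + 16 ε))`.
-/

set_option linter.dupNamespace false

open scoped BigOperators

namespace Summit.MatrixMultiplication.MatrixMultiplication.Theorems.PolynomialSlack

/-- Reindexing a sum over `Fin n` that is supported on the range of an injection
`row : Fin m → Fin n` by the index `c : Fin m` (local copy of the private helper of
`matching_cost_avoid`). -/
private theorem sum_eq_sum_row_of_injective {n m : ℕ} (row : Fin m → Fin n)
    (hrow : Function.Injective row) (φ : Fin n → ℝ)
    (hφ : ∀ x, x ∉ Finset.univ.image row → φ x = 0) :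
    ∑ x, φ x = ∑ c, φ (row c) := by
  rw [← Finset.sum_subset (Finset.subset_univ (Finset.univ.image row)) fun x _ hx => hφ x hx,
    Finset.sum_image hrow.injOn]

set_option maxHeartbeats 800000 in
/-- **Cost of `ε`-avoiding sets at distinct rows.**  `A ⊆ S_n` non-empty, `row` injective,
`P_A(a⁻¹(row c) ∈ Q c) ≤ (1-ε)|Q c|/n` for every `c` (`0 < ε ≤ 1`)
`⇒ ∑_c |Q c|/n ≤ 144 (1 + log n) log (4 (n!/|A|)/ε) / ε²`. [folklore] -/
theorem matching_cost_avoid_eps {n m : ℕ} (hn : 1 ≤ n) (A : Finset (Equiv.Perm (Fin n)))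
    (hA : A.Nonempty) (row : Fin m → Fin n) (hrow : Function.Injective row)
    (Q : Fin m → Finset (Fin n)) (ε : ℝ) (hε : 0 < ε) (hε1 : ε ≤ 1)
    (havoid : ∀ c, ((A.filter fun a => a⁻¹ (row c) ∈ Q c).card : ℝ) ≤
      (1 - ε) * ((Q c).card : ℝ) / n * A.card) :
    ∑ c, ((Q c).card : ℝ) / n ≤
      144 * (1 + Real.log n) * Real.log (4 * ((n.factorial : ℝ) / A.card) / ε) / ε ^ 2 := by
  -- basic quantities: `|A| > 0`, `G = 1 + log n ≥ 1`, `K = n!/|A| ≥ 1`, `L = log(4K/ε) ≥ 0`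
  have hα0 : (0 : ℝ) < A.card := by exact_mod_cast hA.card_pos
  have hnR : (1 : ℝ) ≤ n := by exact_mod_cast hn
  have hn0 : (0 : ℝ) < n := by linarith
  have hG1 : 1 ≤ 1 + Real.log n := by linarith [Real.log_nonneg hnR]
  have hG0 : 0 < 1 + Real.log n := by linarith
  have hαle : (A.card : ℝ) ≤ n.factorial := by
    have : A.card ≤ Fintype.card (Equiv.Perm (Fin n)) := Finset.card_le_univ _
    rw [Fintype.card_perm, Fintype.card_fin] at this
    exact_mod_cast this
  have hK1 : 1 ≤ (n.factorial : ℝ) / A.card := by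
    rw [le_div_iff₀ hα0, one_mul]; exact hαle
  have hY : 4 ≤ 4 * ((n.factorial : ℝ) / A.card) / ε := by
    rw [le_div_iff₀ hε]; nlinarith
  have hY0 : 0 < 4 * ((n.factorial : ℝ) / A.card) / ε := by linarith
  have hL0 : 0 ≤ Real.log (4 * ((n.factorial : ℝ) / A.card) / ε) := Real.log_nonneg (by linarith)
  have hGL : 0 ≤ 144 * (1 + Real.log n) * Real.log (4 * ((n.factorial : ℝ) / A.card) / ε) / ε ^ 2 :=
    div_nonneg (mul_nonneg (mul_nonneg (by norm_num) hG0.le) hL0) (sq_nonneg _)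
  -- the total relative size `μ = ∑_c |Q c|/n`; `μ = 0` is trivial
  set μ : ℝ := ∑ c, ((Q c).card : ℝ) / n with hμ
  have hμ0 : 0 ≤ μ := Finset.sum_nonneg fun c _ => div_nonneg (Nat.cast_nonneg _) hn0.le
  rcases hμ0.eq_or_lt with hμz | hμpos
  · rw [← hμz]; exact hGL
  -- the deviation `t = ε μ / 2`
  set t : ℝ := ε * μ / 2 with ht
  have ht0 : 0 < t := by rw [ht]; exact div_pos (mul_pos hε hμpos) (by norm_num)
  -- the hit count `F a = #{c : a⁻¹ (row c) ∈ Q c}`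
  set F : Equiv.Perm (Fin n) → ℝ := fun a =>
    ((Finset.univ.filter fun c : Fin m => a⁻¹ (row c) ∈ Q c).card : ℝ)
  have hF_apply : ∀ a, F a = ((Finset.univ.filter fun c : Fin m => a⁻¹ (row c) ∈ Q c).card : ℝ) :=
    fun a => rfl
  have hF0 : ∀ a, 0 ≤ F a := fun a => by rw [hF_apply]; exact Nat.cast_nonneg _
  -- double counting: `Σ_{a ∈ A} F a = Σ_c #{a ∈ A : a⁻¹ (row c) ∈ Q c} ≤ (1 - ε) μ |A|`
  have hsumF : ∑ a ∈ A, F a ≤ (1 - ε) * μ * A.card := by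
    have h1 : ∀ a, F a = ∑ c : Fin m, (if a⁻¹ (row c) ∈ Q c then (1 : ℝ) else 0) := fun a => by
      rw [hF_apply, Finset.natCast_card_filter]
    calc ∑ a ∈ A, F a = ∑ a ∈ A, ∑ c : Fin m, (if a⁻¹ (row c) ∈ Q c then (1 : ℝ) else 0) :=
          Finset.sum_congr rfl fun a _ => h1 a
      _ = ∑ c : Fin m, ∑ a ∈ A, (if a⁻¹ (row c) ∈ Q c then (1 : ℝ) else 0) := Finset.sum_comm
      _ = ∑ c : Fin m, ((A.filter fun a => a⁻¹ (row c) ∈ Q c).card : ℝ) :=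
          Finset.sum_congr rfl fun c _ => (Finset.natCast_card_filter _ _).symm
      _ ≤ ∑ c : Fin m, (1 - ε) * ((Q c).card : ℝ) / n * A.card :=
          Finset.sum_le_sum fun c _ => havoid c
      _ = (1 - ε) * μ * A.card := by
          rw [hμ, Finset.mul_sum, Finset.sum_mul]
          exact Finset.sum_congr rfl fun c _ => by ring
  -- Markov: the bad part `B = {a ∈ A : μ - t ≤ F a}` has `(1 - ε/2)|B| ≤ (1 - ε)|A|`
  set B := A.filter fun a => μ - t ≤ F a with hB
  have hB1 : (μ - t) * B.card ≤ (1 - ε) * μ * A.card := by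
    calc (μ - t) * B.card = ∑ _a ∈ B, (μ - t) := by
          rw [Finset.sum_const, nsmul_eq_mul, mul_comm]
      _ ≤ ∑ a ∈ B, F a := Finset.sum_le_sum fun a ha => (Finset.mem_filter.mp ha).2
      _ ≤ ∑ a ∈ A, F a :=
          Finset.sum_le_sum_of_subset_of_nonneg (Finset.filter_subset _ _) fun a _ _ => hF0 a
      _ ≤ _ := hsumF
  have hBA : (B.card : ℝ) ≤ A.card := by exact_mod_cast Finset.card_filter_le _ _
  have hB2 : (1 - ε / 2) * B.card ≤ (1 - ε) * A.card := by
    have h : μ * ((1 - ε / 2) * B.card) ≤ μ * ((1 - ε) * A.card) := by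
      rw [ht] at hB1; linarith
    exact le_of_mul_le_mul_left h hμpos
  -- so the good part `Gd = {a ∈ A : F a < μ - t}` has at least `(ε/2)|A|` elements
  set Gd := A.filter fun a => ¬ μ - t ≤ F a with hGd
  have hGdcard : ε / 2 * (A.card : ℝ) ≤ Gd.card := by
    have h := Finset.card_filter_add_card_filter_not (s := A) (fun a => μ - t ≤ F a)
    have h' : (B.card : ℝ) + (Gd.card : ℝ) = A.card := by rw [hB, hGd]; exact_mod_cast h
    have h2 : ε / 2 * (B.card : ℝ) ≤ ε / 2 * A.card := mul_le_mul_of_nonneg_left hBA (by positivity)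
    linarith
  -- the `0/1` array `b (x, y) = [∃ c, row c = x ∧ y ∈ Q c]`
  set b : Fin n → Fin n → ℝ := fun x y => if ∃ c, row c = x ∧ y ∈ Q c then 1 else 0
  have hb_apply : ∀ x y, b x y = if ∃ c, row c = x ∧ y ∈ Q c then 1 else 0 := fun x y => rfl
  have hb_row : ∀ c y, b (row c) y = if y ∈ Q c then 1 else 0 := by
    intro c y
    rw [hb_apply (row c) y]
    by_cases hy : y ∈ Q c
    · rw [if_pos hy]
      exact if_pos ⟨c, rfl, hy⟩
    · rw [if_neg hy, if_neg]
      rintro ⟨c', hc', hy'⟩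
      exact hy (hrow hc' ▸ hy')
  have hb_off : ∀ x, x ∉ Finset.univ.image row → ∀ y, b x y = 0 := by
    intro x hx y
    rw [hb_apply x y, if_neg]
    rintro ⟨c, hc, -⟩
    exact hx (Finset.mem_image.mpr ⟨c, Finset.mem_univ _, hc⟩)
  have hb01 : ∀ x y, b x y = 0 ∨ b x y = 1 := fun x y => by
    rw [hb_apply x y]
    by_cases h : ∃ c, row c = x ∧ y ∈ Q c
    · exact Or.inr (if_pos h)
    · exact Or.inl (if_neg h)
  have habs : ∀ x y, |b x y| ≤ 1 := fun x y => by
    rcases hb01 x y with h | h <;> rw [h] <;> norm_num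
  -- transport: `Σ_x b (x, π x) = #{c : π (row c) ∈ Q c}`
  have hZ : ∀ π : Equiv.Perm (Fin n),
      ∑ x, b x (π x) = ((Finset.univ.filter fun c : Fin m => π (row c) ∈ Q c).card : ℝ) := by
    intro π
    rw [sum_eq_sum_row_of_injective row hrow (fun x => b x (π x)) fun x hx => hb_off x hx (π x),
      Finset.natCast_card_filter]
    exact Finset.sum_congr rfl fun c _ => hb_row c (π (row c))
  -- the mean `Σ_{x,y} b = Σ_c |Q c|` and the proxy `Σ b² = Σ b`
  have hbsum : ∑ x, ∑ y, b x y = ∑ c : Fin m, ((Q c).card : ℝ) := by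
    rw [sum_eq_sum_row_of_injective row hrow (fun x => ∑ y, b x y) fun x hx =>
      Finset.sum_eq_zero fun y _ => hb_off x hx y]
    refine Finset.sum_congr rfl fun c _ => ?_
    simp only [hb_row, Finset.sum_boole, Finset.filter_univ_mem]
  have hbsq : ∑ x, ∑ y, b x y ^ 2 = ∑ x, ∑ y, b x y :=
    Finset.sum_congr rfl fun x _ => Finset.sum_congr rfl fun y _ => by
      rcases hb01 x y with h | h <;> rw [h] <;> norm_num
  -- Bernstein for the permuted sums of `b` (range `1`, deviation `t`), mean rewritten as `μ`
  have hBound := card_permutedSum_tail_le (n := n) 1 b habs t ht0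
  rw [hbsq, hbsum] at hBound
  have hSdiv : (∑ c : Fin m, ((Q c).card : ℝ)) / n = μ := by rw [hμ, Finset.sum_div]
  have h32 : 32 * (1 + Real.log n) * (∑ c : Fin m, ((Q c).card : ℝ)) / n =
      32 * (1 + Real.log n) * μ := by
    rw [mul_div_assoc, hSdiv]
  rw [hSdiv, h32] at hBound
  -- `a ↦ a⁻¹` maps the good part into the tail
  have hGsub : (Gd.image fun a => a⁻¹).card ≤ (Finset.univ.filter fun π : Equiv.Perm (Fin n) =>
      t ≤ |∑ x, b x (π x) - μ|).card := by
    refine Finset.card_le_card fun π hπ => ?_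
    rw [Finset.mem_image] at hπ
    obtain ⟨a, ha, rfl⟩ := hπ
    rw [Finset.mem_filter] at ha ⊢
    refine ⟨Finset.mem_univ _, ?_⟩
    have hFa : F a < μ - t := not_le.mp ha.2
    have hFa' : ((Finset.univ.filter fun c : Fin m => a⁻¹ (row c) ∈ Q c).card : ℝ) < μ - t := by
      rw [← hF_apply]; exact hFa
    rw [hZ, abs_sub_comm]
    exact le_trans (by linarith) (le_abs_self _)
  have hGimg : (Gd.image fun a => a⁻¹).card = Gd.card :=
    Finset.card_image_of_injective _ inv_injective
  -- the exponent `t²/(32 G μ + 8 t) = ε² μ/(128 G + 16 ε)`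
  have hD1 : (0 : ℝ) < 128 * (1 + Real.log n) + 16 * ε := by linarith
  have hD2 : (0 : ℝ) < 32 * (1 + Real.log n) * μ + 8 * 1 * t := by
    have := mul_pos (mul_pos (by norm_num : (0 : ℝ) < 32) hG0) hμpos
    linarith
  have hexp : t ^ 2 / (32 * (1 + Real.log n) * μ + 8 * 1 * t) =
      ε ^ 2 * μ / (128 * (1 + Real.log n) + 16 * ε) := by
    rw [div_eq_div_iff hD2.ne' hD1.ne', ht]; ring
  -- combine: `(ε/2)|A| ≤ |Gd| ≤ 2·n!·exp(-ε² μ/(128 G + 16 ε))`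
  have hchain : ε / 2 * (A.card : ℝ) ≤
      2 * (n.factorial : ℝ) * Real.exp (-(ε ^ 2 * μ / (128 * (1 + Real.log n) + 16 * ε))) := by
    calc ε / 2 * (A.card : ℝ) ≤ Gd.card := hGdcard
      _ = ((Gd.image fun a => a⁻¹).card : ℝ) := by rw [hGimg]
      _ ≤ ((Finset.univ.filter fun π : Equiv.Perm (Fin n) =>
            t ≤ |∑ x, b x (π x) - μ|).card : ℝ) := by
          exact_mod_cast hGsub
      _ ≤ 2 * (n.factorial : ℝ) * Real.exp (-(t ^ 2 /
            (32 * (1 + Real.log n) * μ + 8 * 1 * t))) := hBound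
      _ = 2 * (n.factorial : ℝ) *
            Real.exp (-(ε ^ 2 * μ / (128 * (1 + Real.log n) + 16 * ε))) := by rw [hexp]
  -- take logarithms: `ε² μ/(128 G + 16 ε) ≤ L`
  have hE : ε ^ 2 * μ / (128 * (1 + Real.log n) + 16 * ε) ≤
      Real.log (4 * ((n.factorial : ℝ) / A.card) / ε) := by
    rw [Real.le_log_iff_exp_le hY0, le_div_iff₀ hε, ← mul_div_assoc, le_div_iff₀ hα0]
    rw [Real.exp_neg, ← div_eq_mul_inv, le_div_iff₀ (Real.exp_pos _)] at hchain
    linarith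
  -- conclude: `ε² μ ≤ (128 G + 16 ε) L ≤ 144 G L`
  have h2 := (div_le_iff₀ hD1).mp hE
  have h3 : Real.log (4 * ((n.factorial : ℝ) / A.card) / ε) * (16 * ε) ≤
      Real.log (4 * ((n.factorial : ℝ) / A.card) / ε) * (16 * (1 + Real.log n)) :=
    mul_le_mul_of_nonneg_left (by linarith) hL0
  rw [le_div_iff₀ (pow_pos hε 2)]
  linarith

end Summit.MatrixMultiplication.MatrixMultiplication.Theorems.PolynomialSlack
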